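import Summits.BirchSwinnertonDyer.BirchSwinnertonDyer.Theorems.ResidualThetaTransportAtTwoSignedMuVanishingAtTwoPlusMultOneOfFacts
import Summits.BirchSwinnertonDyer.BirchSwinnertonDyer.Theorems.ResidualThetaTransportAtTwoSignedMuVanishingAtTwoPlusMultOneRhombic
import Summits.BirchSwinnertonDyer.BirchSwinnertonDyer.Theorems.ResidualThetaTransportAtTwoSignedMuVanishingAtTwoPlusMultOneFlat
import HarnessLib

/-!
# Route `ResidualThetaTransportAtTwo`, crux Kμ⁺ `SignedMuVanishingAtTwoPlus` (stmt-BirchSwinnertonDyer-20689), line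
# `birth`, stub `stub_flatMuZeroAtTwo`: the (MO⁺) DICTIONARY, part 6 — ASSEMBLY ON THE HABITAT⁺: the hypothesis `hMO` of
# `…OldClassCongruence.flatAtTwo_of_multOne` DISCHARGED from four named print facts; FLAT at `(W, f)` modulo those facts, an
# old family of a congruent anchor and ONE odd doubled plus symbol

Cell `bsd-wall`, width seat `bsd-wall-rtt-p4-w2` (g4). THEOREMS ONLY (no `def`, no `sorry`); helper `--supports` the crux;
closes nothing. BSD is not proved by this; the named facts are explicit hypotheses.

## What is proved
For `W/ℚ` globally minimal, good supersingular at `2`, `Δ_W < 0`, with newform `f` (level `N_W`, eigenvalues `A p = a_p(W)`),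
GRANTED the named facts
* `hBuz : buzzard2000_multiplicityOne_gamma0` (Buzzard 2000 Prop. 2.4 — mod-2 multiplicity one for `J₀(N)[𝔪]`),
* `hSe : serre1972_supersingular_decompositionSubgroup_image` (Serre 1972 Prop. 12 — `ρ̄_{W,2}(D₂) = GL₂(𝔽₂)`),
* `hSD : heckeSelfDual_torsionBy_J0` (Darmon–Diamond–Taylor Lemma 1.38 mod `2` — `J₀(N)[2]` is Hecke self-dual),
* `hMK : mazurKenku_exists_cyclic_isogeny` (Mazur 1978 / Kenku — a cyclic `ℚ`-isogeny between isogenous curves):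
* `multOnePlus_of_namedFacts` — (MO⁺), i.e. the hypothesis `hMO` of `…OldClassCongruence.exists_odd_of_multOne` /
  `flatAtTwo_of_multOne` VERBATIM: two non-zero additive maps `Γ₀(N_W) → ZMod 2` through the period functional, even under
  `γ ↦ εγε` and Hecke-eigen with `A p mod 2` at all primes, coincide. Chain: (I) `card_eigenChar_le_four_of_facts` (part 4) ∧
  (II) `half_plusPeriod_not_mem_of_goodSS_of_Δ_neg` (part 5) ⟹ `multOnePlus_of_card_le_four` (part 1b).
* `flatAtTwo_of_namedFacts` — FLAT at `(W, f)`: `2 ∤ L♭` for every Pollack pair `(L♯, L♭)` of `f` at `2`, from the four facts, an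
  old family (`δ`, `H`, `hgood`, `hbad`) of a congruent rational newform `g` of level `N₀` (`hcongr`), and ONE odd doubled plus
  symbol of `g` (`hres`) — `…MultOneFlat.flatAtTwo_of_card_le_four` with (I), (II) discharged.
So the research residue μ(L♭_f) = 0 of `stub_flatMuZeroAtTwo` is, PER HABITAT CLASS, reduced to print (four named facts) plus the
anchor data of the old-class descent (crux workfile `CuspSpanIhara.md` §3.3 (iii), §3.6 (D2): the anchor `A` with `N_A ∣ N_W`,
`A[2] ≅ W[2]`, its old family at level `N_W`, and one odd `2([b/4^k]⁺_A − [0]⁺_A)` — e.g. the layer-0 certificate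
`(a₂(A)−3)(a₂(A)+1)L(A,1)/Ω⁺_A` odd).

References: K. Buzzard, Math. Res. Lett. 7 (2000) Prop. 2.4 [Buzzard2000LevelLoweringModTwo]; J.-P. Serre, Invent. Math. 15
(1972) Prop. 12 [SerreInventiones1972]; H. Darmon, F. Diamond, R. Taylor, *Fermat's Last Theorem* Lemma 1.38
[DarmonDiamondTaylor1995]; B. Mazur, Invent. Math. 44 (1978) [Mazur1978]; M. Emerton, R. Pollack, T. Weston, Invent. Math. 163
(2006) §4.4 [EmertonPollackWeston2006]; R. Pollack, Duke Math. J. 118 (2003) [Pollack2003]; J. E. Cremona (1997) §2.8–2.10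
[CremonaAlgorithms1997].
-/

set_option autoImplicit false
set_option linter.dupNamespace false

noncomputable section

open scoped Classical MatrixGroups ModularForm

open CongruenceSubgroup WeierstrassCurve Literature.NumberTheory.EllipticCurves
  Literature.NumberTheory.EllipticCurves.ModularForms Literature.NumberTheory.EllipticCurves.Rank1Residual
  Literature.NumberTheory.IwasawaTheory Summit.BirchSwinnertonDyer.Rank1Residual.Supersingular
  Summit.BirchSwinnertonDyer.BirchSwinnertonDyer.Theses.ResidualThetaTransportAtTwo

namespace Summit.BirchSwinnertonDyer.BirchSwinnertonDyer.Theorems.SignedMuAtTwo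

namespace MultOneDictionary

variable {W : WeierstrassCurve ℚ} [W.IsElliptic] [W.IsGloballyMinimal]

/-- **(MO⁺) on the habitat⁺ from four named facts.** `W/ℚ` globally minimal, good supersingular at `2`, `Δ_W < 0`, newform `f`
of level `N_W` with eigenvalues `A p`; granted `buzzard2000_multiplicityOne_gamma0`, `serre1972_supersingular_decompositionSubgroup_image`,
`heckeSelfDual_torsionBy_J0`, `mazurKenku_exists_cyclic_isogeny`: any two NON-ZERO maps `χ₁, χ₂ : Γ₀(N_W) → ZMod 2` that are
additive, factor through the period functional, are even under `γ ↦ εγε` and are Hecke eigencharacters with `A p mod 2` at all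
primes COINCIDE — the hypothesis `hMO` of `…OldClassCongruence.flatAtTwo_of_multOne`, verbatim.
[cite: Buzzard2000LevelLoweringModTwo, Prop. 2.4 and Def. 2.1–2.2 (p. 100–101)] [cite: SerreInventiones1972, §1.11 Prop. 12 (c),(d)]
[cite: DarmonDiamondTaylor1995, §1.6 Lemma 1.38 (p. 41) and §4.5 (p. 134)] [cite: Mazur1978, Thm. 1] -/
theorem multOnePlus_of_namedFacts (hBuz : buzzard2000_multiplicityOne_gamma0)
    (hSe : serre1972_supersingular_decompositionSubgroup_image) (hSD : heckeSelfDual_torsionBy_J0)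
    (hMK : mazurKenku_exists_cyclic_isogeny)
    (hss : GoodSS W 2) (hΔ : W.Δ < 0) [NeZero (W.conductorNorm ℤ)] {f : CuspForm (Gamma0 (W.conductorNorm ℤ)) 2}
    (hf : IsNewformOf W f) (A : ℕ → ℤ) (hA : ∀ p : ℕ, p.Prime → cuspCoeff f p = (A p : ℂ)) :
    ∀ χ₁ χ₂ : Gamma0 (W.conductorNorm ℤ) → ZMod 2,
      (∀ γ γ' : Gamma0 (W.conductorNorm ℤ), χ₁ (γ * γ') = χ₁ γ + χ₁ γ') →
      (∀ γ γ' : Gamma0 (W.conductorNorm ℤ),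
        periodFunctional (W.conductorNorm ℤ) γ = periodFunctional (W.conductorNorm ℤ) γ' → χ₁ γ = χ₁ γ') →
      (∀ γ γ' : Gamma0 (W.conductorNorm ℤ), (γ' : SL(2, ℤ)) 0 0 = (γ : SL(2, ℤ)) 0 0 →
        (γ' : SL(2, ℤ)) 1 0 = -((γ : SL(2, ℤ)) 1 0) → χ₁ γ' = χ₁ γ) →
      (∀ (p : ℕ) (hp : p.Prime) (γ σ : Gamma0 (W.conductorNorm ℤ)),
        periodFunctional (W.conductorNorm ℤ) σ =
          (haveI : NeZero p := ⟨hp.ne_zero⟩; heckeT (Gamma0 (W.conductorNorm ℤ)) 2 p).dualMap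
            (periodFunctional (W.conductorNorm ℤ) γ) →
        χ₁ σ = ((A p : ℤ) : ZMod 2) * χ₁ γ) →
      (∀ γ γ' : Gamma0 (W.conductorNorm ℤ), χ₂ (γ * γ') = χ₂ γ + χ₂ γ') →
      (∀ γ γ' : Gamma0 (W.conductorNorm ℤ),
        periodFunctional (W.conductorNorm ℤ) γ = periodFunctional (W.conductorNorm ℤ) γ' → χ₂ γ = χ₂ γ') →
      (∀ γ γ' : Gamma0 (W.conductorNorm ℤ), (γ' : SL(2, ℤ)) 0 0 = (γ : SL(2, ℤ)) 0 0 →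
        (γ' : SL(2, ℤ)) 1 0 = -((γ : SL(2, ℤ)) 1 0) → χ₂ γ' = χ₂ γ) →
      (∀ (p : ℕ) (hp : p.Prime) (γ σ : Gamma0 (W.conductorNorm ℤ)),
        periodFunctional (W.conductorNorm ℤ) σ =
          (haveI : NeZero p := ⟨hp.ne_zero⟩; heckeT (Gamma0 (W.conductorNorm ℤ)) 2 p).dualMap
            (periodFunctional (W.conductorNorm ℤ) γ) →
        χ₂ σ = ((A p : ℤ) : ZMod 2) * χ₂ γ) →
      (∃ γ, χ₁ γ ≠ 0) → (∃ γ, χ₂ γ ≠ 0) → ∀ γ, χ₁ γ = χ₂ γ :=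
  multOnePlus_of_card_le_four f hf.1 hf.coeffField_eq_bot A hA
    (fun s hs ↦ card_eigenChar_le_four_of_facts hBuz hSe hSD hss hf A hA s hs)
    (half_plusPeriod_not_mem_of_goodSS_of_Δ_neg hMK hss hΔ hf)

/-- **FLAT at `(W, f)` on the habitat⁺, modulo four named facts, an old family and one certificate.** `W/ℚ` globally minimal,
good supersingular at `2` with `a₂(W) = 0`, `Δ_W < 0`, newform `f` (eigenvalues `A p`); granted
`buzzard2000_multiplicityOne_gamma0`, `serre1972_supersingular_decompositionSubgroup_image`, `heckeSelfDual_torsionBy_J0`,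
`mazurKenku_exists_cyclic_isogeny`; an old family (`δ`, `H`, `hgood`, `hbad`) of a congruent rational newform `g` of odd level
`N₀` (`a₂(g)` even, `a_p(f) ≡ a_p(g)` for `p ∤ N_W`), and ONE odd doubled plus symbol `2([b/4^k]⁺_g − [0]⁺_g)` (`k ≥ 1`, `b` odd):
`2 ∤ L♭` for every Pollack pair `(L♯, L♭)` of `f` at `2` (μ(L♭_f) = 0). This is `…OldClassCongruence.flatAtTwo_of_multOne` with its
multiplicity-one hypothesis `hMO` DISCHARGED (`multOnePlus_of_namedFacts`). [cite: Buzzard2000LevelLoweringModTwo, Prop. 2.4]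
[cite: DarmonDiamondTaylor1995, §1.6 Lemma 1.38] [cite: SerreInventiones1972, §1.11 Prop. 12] [cite: Mazur1978, Thm. 1]
[cite: EmertonPollackWeston2006, §4.4] [cite: Pollack2003, Conj. 6.3 and Prop. 6.18] -/
theorem flatAtTwo_of_namedFacts (hBuz : buzzard2000_multiplicityOne_gamma0)
    (hSe : serre1972_supersingular_decompositionSubgroup_image) (hSD : heckeSelfDual_torsionBy_J0)
    (hMK : mazurKenku_exists_cyclic_isogeny)
    (hss : GoodSS W 2) (ha : W.frobeniusTrace 2 = 0) (hΔ : W.Δ < 0) [NeZero (W.conductorNorm ℤ)]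
    {f : CuspForm (Gamma0 (W.conductorNorm ℤ)) 2} (hf : IsNewformOf W f)
    (A : ℕ → ℤ) (hA : ∀ p : ℕ, p.Prime → cuspCoeff f p = (A p : ℂ))
    {N₀ : ℕ} [NeZero N₀] (g : CuspForm (Gamma0 N₀) 2) (hg : IsNewform0 g) (hQg : coeffField g = ⊥)
    (h2N₀ : ¬ 2 ∣ N₀) (B : ℕ → ℤ) (hB : ∀ p : ℕ, p.Prime → cuspCoeff g p = (B p : ℂ)) (haev : Even (B 2))
    (hcongr : ∀ p : ℕ, p.Prime → ¬ p ∣ W.conductorNorm ℤ → ((A p : ℤ) : ZMod 2) = ((B p : ℤ) : ZMod 2))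
    (S : Finset ℕ) (hS : S.Nonempty) (hodd : ∀ t ∈ S, Odd t)
    (δ : ℕ → (Gamma0 (W.conductorNorm ℤ) →* Gamma0 N₀))
    (hδ00 : ∀ t ∈ S, ∀ γ : Gamma0 (W.conductorNorm ℤ), ((δ t γ : Gamma0 N₀) : SL(2, ℤ)) 0 0 = (γ : SL(2, ℤ)) 0 0)
    (hδ01 : ∀ t ∈ S, ∀ γ : Gamma0 (W.conductorNorm ℤ),
      ((δ t γ : Gamma0 N₀) : SL(2, ℤ)) 0 1 = (t : ℤ) * (γ : SL(2, ℤ)) 0 1)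
    (hδ10 : ∀ t ∈ S, ∀ γ : Gamma0 (W.conductorNorm ℤ),
      ((δ t γ : Gamma0 N₀) : SL(2, ℤ)) 1 0 = (γ : SL(2, ℤ)) 1 0 / t)
    (hδ11 : ∀ t ∈ S, ∀ γ : Gamma0 (W.conductorNorm ℤ), ((δ t γ : Gamma0 N₀) : SL(2, ℤ)) 1 1 = (γ : SL(2, ℤ)) 1 1)
    (hδdvd : ∀ t ∈ S, ∀ γ : Gamma0 (W.conductorNorm ℤ), (t : ℤ) ∣ (γ : SL(2, ℤ)) 1 0)
    (H : CuspForm (Gamma0 (W.conductorNorm ℤ)) 2)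
    (hH : ∀ γ : Gamma0 (W.conductorNorm ℤ), cuspSymbol H γ = ∑ t ∈ S, cuspSymbol g (δ t γ))
    (hHgood : ∀ (p : ℕ) (hp : p.Prime), ¬ p ∣ W.conductorNorm ℤ →
      (haveI : NeZero p := ⟨hp.ne_zero⟩; heckeT (Gamma0 (W.conductorNorm ℤ)) 2 p) H = ((B p : ℤ) : ℂ) • H)
    (hbad : ∀ (p : ℕ) (hp : p.Prime), p ∣ W.conductorNorm ℤ → ∀ γ σ : Gamma0 (W.conductorNorm ℤ),
      periodFunctional (W.conductorNorm ℤ) σ =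
        (haveI : NeZero p := ⟨hp.ne_zero⟩; heckeT (Gamma0 (W.conductorNorm ℤ)) 2 p).dualMap
          (periodFunctional (W.conductorNorm ℤ) γ) →
      ∀ mσ mγ : ℤ, (cuspSymbol H σ).re = mσ * (plusPeriod g / 2) → (cuspSymbol H γ).re = mγ * (plusPeriod g / 2) →
        (mσ : ZMod 2) = ((A p : ℤ) : ZMod 2) * (mγ : ZMod 2))
    (hres : ∃ k : ℕ, 1 ≤ k ∧ ∃ b : ℤ, Odd b ∧ ∃ m : ℤ, Odd m ∧
      ratPlusSymbol g ((b : ℚ) / 4 ^ k) = ratPlusSymbol g 0 + (m : ℚ) / 2) :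
    ∀ Lplus Lminus : IwasawaAlgebra 2, IsPollackPair f 2 Lplus Lminus → ¬ PowerSeries.C (2 : ℤ_[2]) ∣ Lminus :=
  flatAtTwo_of_card_le_four hf hss ha A hA
    (fun s hs ↦ card_eigenChar_le_four_of_facts hBuz hSe hSD hss hf A hA s hs)
    (half_plusPeriod_not_mem_of_goodSS_of_Δ_neg hMK hss hΔ hf)
    g hg hQg h2N₀ B hB haev hcongr S hS hodd δ hδ00 hδ01 hδ10 hδ11 hδdvd H hH hHgood hbad hres

end MultOneDictionary

end Summit.BirchSwinnertonDyer.BirchSwinnertonDyer.Theorems.SignedMuAtTwo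

end
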